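/-
Copyright: public-domain mathematics; typed transcription for the H21 Literature library (cell lit-balaban,
Phase-2 proof seat p38 gen 7 = literature-prover-lit-balaban-p38-g7-0).

statement-level skeleton of published theorems with citation tags; proofs where landed; nothing here is a claim about the Yang–Mills mass gap

# Bałaban, *Propagators and renormalization transformations for lattice gauge theories. I*,
# Commun. Math. Phys. **95** (1984) 17–40 — THE FIRST-FACTOR ESTIMATES OF THE RANDOM WALK FOR `G = Δ_a⁻¹` OF RECORD:
# lattice Leibniz rules for `∇(h_zA)`, `∇∇(h_zA)`, `h_z∇*J` on `T_η`, uniformly in `η`, and (1.89) on real tensor sources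

[cite: Balaban1984PropagatorsI]  T. Bałaban, Commun. Math. Phys. 95 (1984) 17–40.  p. 33 Prop. 1.1 «‖GJ‖, ‖∇GJ‖, ‖G∇*J‖, ‖∇G∇*J‖,
‖∇∇GJ‖, ‖G∇*∇*J‖ ≤ γ₀⁻¹‖J‖, (1.89)»; p. 38 (1.125) «For the first factor we have ‖ζ∇h_zGh_zA‖_α ≤ O(1)(‖ζ‖_α + |ζ|)|h_zA|»;
(1.129) «The last factor in each term is estimated by using (1.115), (1.116) |∇Gh_z∇*J| + |Gh_z∇*J| ≤ O(1)(‖J‖_ε + |J|)»; (1.130)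
«There is one possibility left yet, namely that of the terms with one factor. Then we apply the inequality (1.117) together with (1.115),
(1.116) and we get (1.130)» [display (1.130), reconstructed from the formula layer: ‖ζ∇h_zGh_z∇*J‖_α ≤ O(1)(‖ζ‖_α + |ζ|)(‖J‖_{α+ε} + |J|)];
p. 39 «Let us notice that the proof of inequalities (1.114), describing the decay in L²-norms, is completed because we have proved
inequalities (1.89)»; p. 37 (1.121) (the derivatives «∂h», «Δh» of the partition functions).

WHAT THIS MODULE ADDS (SKELETON rows B5.Eq1.125 / B5.Eq1.129–1.130 in their L² reading, owner r02; GAPS G-B5-03, G-B5-24 (the located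
leaves `RightCert`/`LeftCert` of `B5Local114`); target: the certificates of `B5Local114.Realisation` for r02's operator of record).
The slice-level analysis the L² certificates need, on real fields `v : T_η × {1..d} → ℝ` with the multiplier `h_z` of
`B5WalkPartitionTorus` (bond form `gz` of `B5WalkH128Torus`):
* §1 (1.89) FOR REAL TENSOR SOURCES, members `‖G∇*J‖`, `‖∇G∇*J‖`, `‖∇∇GJ‖`, `‖G∇*∇*J‖` (pv15's complexification dictionary; members
  `‖GJ‖`, `‖∇GJ‖` are `B5WalkCarrierTorus.l2R_GR_le_of_clause` / `l2TR_gradR_GR_le_of_clause`);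
* §2 tensor `ℓ²` bookkeeping (`l2TR` of sums, pointwise-dominated families, slices);
* §3 FIRST-ORDER LEIBNIZ `∇_ν(h v) = (τ_νh)·∇_νv + (∇_νh)·v` and `‖∇(h_z v)‖ ≤ ‖∇v‖ + √d(Lw/M₀)‖v‖` (`∂h = O(M₀⁻¹)` (the «small factor O(M₀⁻¹)» of (1.128)));
* §4 MIXED SECOND DIFFERENCES of the product profile `h_z = Π_μ h_μ` (`|Δ_{νν′}h_z| ≤ Kmix/M₀²·η²`, per-axis factorisation for ν ≠ ν′,
  the centred axis bound of `B5WalkPartitionTorus` for ν = ν′) and SECOND-ORDER LEIBNIZ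
  `‖∇∇(h_z v)‖ ≤ d²(‖∇∇v‖ + 2(Lw/M₀)‖∇v‖ + (Kmix/M₀²)‖v‖)`;
* §5 THE DIVERGENCE COMMUTATOR `h·∇*J = ∇*(h·J) + E`, `‖E‖ ≤ d(Lw/M₀)‖J‖` (the adjoint reading «K(h) acting on the right», p. 39).
All bounds uniform in `η`, the volume and `M₀ ≥ 1`.

HONEST SCOPE.  L² (not Hölder) readings, as p. 39 uses for (1.114); constants unoptimised (`d²`, `√d`).  value = slice lemmas for the
located leaves `hcert` of `B5Local114.Realisation` for the torus of record — NOT summit progress.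
-/
import Mathlib
import Literature.MathematicalPhysics.QuantumFieldTheory.Balaban1983to89.B5WalkH128Torus

open scoped BigOperators Real Matrix ComplexConjugate
open Finset Matrix

namespace Literature.MathematicalPhysics.QuantumFieldTheory.Balaban1983to89.B5WalkLeibnizTorus

open Literature.MathematicalPhysics.QuantumFieldTheory.Balaban1983to89
open Literature.MathematicalPhysics.QuantumFieldTheory.Balaban1983to89.B5Prop11Plancherel (Tor fine unitVec)
open Literature.MathematicalPhysics.QuantumFieldTheory.Balaban1983to89.B5DeltaA169 (DeltaA)
open Literature.MathematicalPhysics.QuantumFieldTheory.Balaban1983to89.B5Prop11Lattice (l2 l2T grad grad2 divT divT2)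
open Literature.MathematicalPhysics.QuantumFieldTheory.Balaban1983to89.B5Prop11SettingModel (Loc189 locNorm l2op189)
open Literature.MathematicalPhysics.QuantumFieldTheory.Balaban1983to89.B5Prop12FieldsLattice (distU distU_nonneg)
open Literature.MathematicalPhysics.QuantumFieldTheory.Balaban1983to89.B5CombesThomasLattice (nb distU_step_le)
open Literature.MathematicalPhysics.QuantumFieldTheory.Balaban1983to89.B5CoverP12Lattice (distU_comm Lw Lw_nonneg abs_crep_le_abs)
open Literature.MathematicalPhysics.QuantumFieldTheory.Balaban1983to89.B5Partition118Printed (crep hper)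
open Literature.MathematicalPhysics.QuantumFieldTheory.Balaban1983to89.B4PartitionUnity22 (hprof D1 D2)
open Literature.MathematicalPhysics.QuantumFieldTheory.Balaban1983to89.B5RealFields (GR fdiffR l2R l2TR gradR grad2R divTR divT2R cplx
  cplx_apply l2R_eq l2TR_eq l2R_nonneg l2R_le_l2TR cplx_GR_mulVec cplx_gradR cplx_grad2R cplx_divTR cplx_divT2R)
open Literature.MathematicalPhysics.QuantumFieldTheory.Balaban1983to89.B5SettingP12Weighted (sqEta sqEta_nonneg)
open Literature.MathematicalPhysics.QuantumFieldTheory.Balaban1983to89.B5SettingP12Real (LocR latticeSettingP12R)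
open Literature.MathematicalPhysics.QuantumFieldTheory.Balaban1983to89.B5WalkTorusGeom (TorR ucPt Cen ctr nCtr sp sp_pos half_le_sp
  one_le_nCtr nCtr_mul_sp)
open Literature.MathematicalPhysics.QuantumFieldTheory.Balaban1983to89.B5WalkTorusGeom.TorR (shift shift_c_self shift_c_of_ne)
open Literature.MathematicalPhysics.QuantumFieldTheory.Balaban1983to89.B5WalkPartitionTorus (prof prof_nonneg prof_le_one hz
  abs_prof_sub_le)
open Literature.MathematicalPhysics.QuantumFieldTheory.Balaban1983to89.B5WalkCarrierTorus (Bnd l2R_sq l2TR_sq sqEta_pos)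
open Literature.MathematicalPhysics.QuantumFieldTheory.Balaban1983to89.B5WalkEntriesTorus (l2TR_sq_sum l2TR_nonneg l2R_zero)
open Literature.MathematicalPhysics.QuantumFieldTheory.Balaban1983to89.B5WalkH128Torus (pb nb_pb pb_nb nbEquiv fdiffR_mulVec_apply
  fdiffR_transpose_mulVec_apply gz abs_gz_le_one abs_gz_nb_sub_le abs_gz_pb_sub_le abs_gz_second_diff_le K2 K2_nonneg gz_nb
  ucPt_add_unitVec shift_shift hz_shift_period l2R_add_le l2R_sum_le l2R_mul_le l2R_comp_equiv nb_fst)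

noncomputable section

variable {d : ℕ}

/-! ## §1 (1.89) for real tensor sources: members `‖G∇*J‖`, `‖∇G∇*J‖`, `‖∇∇GJ‖`, `‖G∇*∇*J‖` -/

section Transfers

variable {n : ℕ} [NeZero n] {M : Fin d → ℕ} [hM : ∀ μ, NeZero (M μ)] {a : ℝ} {k : ℕ}

/-- member `‖G∇*J‖` of (1.89) at a real 2-tensor source, in pv15's real norms. [cite: Balaban1984PropagatorsI, Prop. 1.1 (1.89) p.33] -/
theorem l2R_GR_divTR_le_of_clause (hn : 1 ≤ n) {γ₀ : ℝ}
    (hcl : ∀ (m : Fin 6) (J : LocR n M), (latticeSettingP12R n M a k).l2op m J ≤ γ₀⁻¹ * (latticeSettingP12R n M a k).l2Norm J)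
    (J : Fin d → Bnd n M → ℝ) : l2R (GR n M a *ᵥ divTR n M J) ≤ γ₀⁻¹ * l2TR J := by
  have h := hcl 2 (LocR.ten J)
  change sqEta n d * l2op189 n M a 2 (Loc189.ten fun s => cplx (J s))
    ≤ γ₀⁻¹ * (sqEta n d * locNorm (Loc189.ten fun s => cplx (J s))) at h
  rw [B5Prop11SettingModel.l2op189_two_ten] at h
  change sqEta n d * l2 ((DeltaA n M a)⁻¹ *ᵥ divT n M fun s => cplx (J s)) ≤ γ₀⁻¹ * (sqEta n d * l2T fun s => cplx (J s)) at h
  rw [← cplx_divTR, ← cplx_GR_mulVec n M a, ← l2R_eq, ← l2TR_eq] at h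
  have hs := sqEta_pos n hn (d := d)
  nlinarith

/-- member `‖∇G∇*J‖` of (1.89) at a real 2-tensor source. [cite: Balaban1984PropagatorsI, Prop. 1.1 (1.89) p.33] -/
theorem l2TR_gradR_GR_divTR_le_of_clause (hn : 1 ≤ n) {γ₀ : ℝ}
    (hcl : ∀ (m : Fin 6) (J : LocR n M), (latticeSettingP12R n M a k).l2op m J ≤ γ₀⁻¹ * (latticeSettingP12R n M a k).l2Norm J)
    (J : Fin d → Bnd n M → ℝ) : l2TR (gradR n M (GR n M a *ᵥ divTR n M J)) ≤ γ₀⁻¹ * l2TR J := by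
  have h := hcl 3 (LocR.ten J)
  change sqEta n d * l2op189 n M a 3 (Loc189.ten fun s => cplx (J s))
    ≤ γ₀⁻¹ * (sqEta n d * locNorm (Loc189.ten fun s => cplx (J s))) at h
  rw [B5Prop11SettingModel.l2op189_three_ten] at h
  change sqEta n d * l2T (grad n M ((DeltaA n M a)⁻¹ *ᵥ divT n M fun s => cplx (J s)))
    ≤ γ₀⁻¹ * (sqEta n d * l2T fun s => cplx (J s)) at h
  have e : l2T (grad n M ((DeltaA n M a)⁻¹ *ᵥ divT n M fun s => cplx (J s))) = l2TR (gradR n M (GR n M a *ᵥ divTR n M J)) := by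
    rw [l2TR_eq, ← cplx_divTR, ← cplx_GR_mulVec n M a]
    congr 1
    funext ν
    rw [cplx_gradR]
  rw [e, ← l2TR_eq] at h
  have hs := sqEta_pos n hn (d := d)
  nlinarith

/-- member `‖∇∇GJ‖` of (1.89) at a real vector source. [cite: Balaban1984PropagatorsI, Prop. 1.1 (1.89) p.33] -/
theorem l2TR_grad2R_GR_le_of_clause (hn : 1 ≤ n) {γ₀ : ℝ}
    (hcl : ∀ (m : Fin 6) (J : LocR n M), (latticeSettingP12R n M a k).l2op m J ≤ γ₀⁻¹ * (latticeSettingP12R n M a k).l2Norm J)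
    (v : Bnd n M → ℝ) : l2TR (grad2R n M (GR n M a *ᵥ v)) ≤ γ₀⁻¹ * l2R v := by
  have h := hcl 4 (LocR.vec v)
  change sqEta n d * l2op189 n M a 4 (Loc189.vec (cplx v)) ≤ γ₀⁻¹ * (sqEta n d * locNorm (Loc189.vec (cplx v))) at h
  rw [B5Prop11SettingModel.l2op189_four_vec] at h
  change sqEta n d * l2T (grad2 n M ((DeltaA n M a)⁻¹ *ᵥ cplx v)) ≤ γ₀⁻¹ * (sqEta n d * l2 (cplx v)) at h
  have e : l2T (grad2 n M ((DeltaA n M a)⁻¹ *ᵥ cplx v)) = l2TR (grad2R n M (GR n M a *ᵥ v)) := by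
    rw [l2TR_eq, ← cplx_GR_mulVec n M a]
    congr 1
    funext p
    rw [cplx_grad2R]
  rw [e, ← l2R_eq] at h
  have hs := sqEta_pos n hn (d := d)
  nlinarith

/-- member `‖G∇*∇*J‖` of (1.89) at a real 3-tensor source. [cite: Balaban1984PropagatorsI, Prop. 1.1 (1.89) p.33] -/
theorem l2R_GR_divT2R_le_of_clause (hn : 1 ≤ n) {γ₀ : ℝ}
    (hcl : ∀ (m : Fin 6) (J : LocR n M), (latticeSettingP12R n M a k).l2op m J ≤ γ₀⁻¹ * (latticeSettingP12R n M a k).l2Norm J)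
    (J : Fin d × Fin d → Bnd n M → ℝ) : l2R (GR n M a *ᵥ divT2R n M J) ≤ γ₀⁻¹ * l2TR J := by
  have h := hcl 5 (LocR.ten2 J)
  change sqEta n d * l2op189 n M a 5 (Loc189.ten2 fun s => cplx (J s))
    ≤ γ₀⁻¹ * (sqEta n d * locNorm (Loc189.ten2 fun s => cplx (J s))) at h
  rw [B5Prop11SettingModel.l2op189_five_ten2] at h
  change sqEta n d * l2 ((DeltaA n M a)⁻¹ *ᵥ divT2 n M fun s => cplx (J s)) ≤ γ₀⁻¹ * (sqEta n d * l2T fun s => cplx (J s)) at h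
  rw [← cplx_divT2R, ← cplx_GR_mulVec n M a, ← l2R_eq, ← l2TR_eq] at h
  have hs := sqEta_pos n hn (d := d)
  nlinarith

end Transfers

/-! ## §2 Tensor `ℓ²` bookkeeping -/

section L2T

variable {S m : Type*} [Fintype S] [Fintype m]

/-- `l2TR F` is the plain `l2R` of the uncurried field. (ℓ² plumbing for the L²-norms of (1.108)/(1.114)) [cite: Balaban1984PropagatorsI, p.35 («Besides these we use also L²-norms»), (1.21) p.21] -/
theorem l2TR_eq_l2R_uncurry (F : S → m → ℝ) : l2TR F = l2R (fun p : S × m => F p.1 p.2) := by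
  unfold l2TR l2R
  rw [Fintype.sum_prod_type]

/-- `‖F + G‖ ≤ ‖F‖ + ‖G‖` for tensor fields. (ℓ² plumbing for the L²-norms of (1.108)/(1.114)) [cite: Balaban1984PropagatorsI, p.35 («Besides these we use also L²-norms»), (1.21) p.21] -/
theorem l2TR_add_le (F G : S → m → ℝ) : l2TR (F + G) ≤ l2TR F + l2TR G := by
  rw [l2TR_eq_l2R_uncurry, l2TR_eq_l2R_uncurry, l2TR_eq_l2R_uncurry]
  exact l2R_add_le (fun p : S × m => F p.1 p.2) (fun p : S × m => G p.1 p.2)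

/-- pointwise domination `|F| ≤ |G|` gives `‖F‖ ≤ ‖G‖`. (ℓ² plumbing for the L²-norms of (1.108)/(1.114)) [cite: Balaban1984PropagatorsI, p.35 («Besides these we use also L²-norms»), (1.21) p.21] -/
theorem l2TR_le_of_abs_le {F G : S → m → ℝ} (h : ∀ s i, |F s i| ≤ |G s i|) : l2TR F ≤ l2TR G := by
  unfold l2TR
  exact Real.sqrt_le_sqrt (Finset.sum_le_sum fun s _ => Finset.sum_le_sum fun i _ => sq_le_sq.mpr (h s i))

/-- pointwise domination `|u| ≤ |w|` gives `‖u‖ ≤ ‖w‖`. (ℓ² plumbing for the L²-norms of (1.108)/(1.114)) [cite: Balaban1984PropagatorsI, p.35 («Besides these we use also L²-norms»), (1.21) p.21] -/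
theorem l2R_le_of_abs_le {u w : m → ℝ} (h : ∀ i, |u i| ≤ |w i|) : l2R u ≤ l2R w := by
  unfold l2R
  exact Real.sqrt_le_sqrt (Finset.sum_le_sum fun i _ => sq_le_sq.mpr (h i))

/-- `‖F‖ ≤ Σ_s ‖F_s‖`. (ℓ² plumbing for the L²-norms of (1.108)/(1.114)) [cite: Balaban1984PropagatorsI, p.35 («Besides these we use also L²-norms»), (1.21) p.21] -/
theorem l2TR_le_sum_l2R (F : S → m → ℝ) : l2TR F ≤ ∑ s, l2R (F s) := by
  have h2 : l2TR F ^ 2 ≤ (∑ s, l2R (F s)) ^ 2 := by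
    rw [l2TR_sq_sum]
    exact Finset.sum_sq_le_sq_sum_of_nonneg fun s _ => l2R_nonneg (F s)
  exact (pow_le_pow_iff_left₀ (l2TR_nonneg F) (Finset.sum_nonneg fun s _ => l2R_nonneg (F s)) two_ne_zero).mp h2

/-- uniform slice bounds: `‖F_s‖ ≤ c` for all `s` gives `‖F‖ ≤ √|S|·c`. (ℓ² plumbing for the L²-norms of (1.108)/(1.114)) [cite: Balaban1984PropagatorsI, p.35 («Besides these we use also L²-norms»), (1.21) p.21] -/
theorem l2TR_le_of_forall_le {F : S → m → ℝ} {c : ℝ} (hc : 0 ≤ c) (h : ∀ s, l2R (F s) ≤ c) :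
    l2TR F ≤ Real.sqrt (Fintype.card S) * c := by
  have h2 : l2TR F ^ 2 ≤ (Real.sqrt (Fintype.card S) * c) ^ 2 := by
    rw [l2TR_sq_sum, mul_pow, Real.sq_sqrt (Nat.cast_nonneg _)]
    calc ∑ s, l2R (F s) ^ 2 ≤ ∑ _s : S, c ^ 2 := Finset.sum_le_sum fun s _ => pow_le_pow_left₀ (l2R_nonneg _) (h s) 2
      _ = Fintype.card S * c ^ 2 := by rw [Finset.sum_const, Finset.card_univ, nsmul_eq_mul]
  exact (pow_le_pow_iff_left₀ (l2TR_nonneg F) (by positivity) two_ne_zero).mp h2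

/-- a multiplier bounded by `1` does not increase `‖F‖`. (ℓ² plumbing for the L²-norms of (1.108)/(1.114)) [cite: Balaban1984PropagatorsI, p.35 («Besides these we use also L²-norms»), (1.21) p.21] -/
theorem l2TR_smul_le {g : m → ℝ} (hg : ∀ i, |g i| ≤ 1) (F : S → m → ℝ) : l2TR (fun s i => g i * F s i) ≤ l2TR F :=
  l2TR_le_of_abs_le fun s i => by
    rw [abs_mul]
    exact (mul_le_of_le_one_left (abs_nonneg _) (hg i))

/-- a multiplier bounded by `1` does not increase `‖u‖`. (ℓ² plumbing for the L²-norms of (1.108)/(1.114)) [cite: Balaban1984PropagatorsI, p.35 («Besides these we use also L²-norms»), (1.21) p.21] -/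
theorem l2R_smul_le {g : m → ℝ} (hg : ∀ i, |g i| ≤ 1) (u : m → ℝ) : l2R (fun i => g i * u i) ≤ l2R u :=
  l2R_le_of_abs_le fun i => by
    rw [abs_mul]
    exact (mul_le_of_le_one_left (abs_nonneg _) (hg i))

end L2T

/-! ## §3 First-order Leibniz: `∇_ν(h v) = (τ_νh)·∇_νv + (∇_νh)·v` -/

section Leibniz1

variable {n : ℕ} [NeZero n] {M : Fin d → ℕ} [hM : ∀ μ, NeZero (M μ)] {M₀ : ℕ}

/-- **the lattice Leibniz rule**: `∇_ν(g·v)(b) = g(b + e_ν)·(∇_νv)(b) + n(g(b + e_ν) − g(b))·v(b)`. [cite: Balaban1984PropagatorsI, (1.121) p.37 («(∂h)(b)»)] -/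
theorem fdiffR_mulVec_mul_apply (g v : Bnd n M → ℝ) (ν : Fin d) (b : Bnd n M) :
    (fdiffR n M ν *ᵥ fun b' => g b' * v b') b
      = g (nb n M ν b) * (fdiffR n M ν *ᵥ v) b + (n * (g (nb n M ν b) - g b)) * v b := by
  rw [fdiffR_mulVec_apply, fdiffR_mulVec_apply]
  ring

/-- the Leibniz rule as an identity of tensor fields: `∇(g·v) = A + B`. [cite: Balaban1984PropagatorsI, (1.121) p.37] -/
theorem gradR_mul_eq (g v : Bnd n M → ℝ) :
    gradR n M (fun b => g b * v b)
      = (fun ν b => g (nb n M ν b) * gradR n M v ν b) + fun ν b => (n * (g (nb n M ν b) - g b)) * v b := by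
  funext ν b
  simp only [Pi.add_apply, gradR]
  exact fdiffR_mulVec_mul_apply g v ν b

/-- **`‖∇(h_z v)‖ ≤ ‖∇v‖ + √d·(Lw/M₀)·‖v‖`** — `∂h = O(M₀⁻¹)` (the «small factor O(M₀⁻¹)» of (1.128)), the first factor of (1.125) in `L²`, uniformly in `η`.
[cite: Balaban1984PropagatorsI, (1.125) p.38, (1.121) p.37] -/
theorem l2TR_gradR_gz_mul_le (hn : 1 ≤ n) (hM₀ : 1 ≤ M₀) (z : Cen M M₀) (v : Bnd n M → ℝ) :
    l2TR (gradR n M fun b => gz n M M₀ z b * v b) ≤ l2TR (gradR n M v) + Real.sqrt d * (Lw d / M₀) * l2R v := by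
  have hnpos : (0 : ℝ) < n := Nat.cast_pos.mpr (NeZero.pos n)
  have hL : 0 ≤ Lw d / M₀ := div_nonneg (Lw_nonneg d) (Nat.cast_nonneg _)
  rw [gradR_mul_eq]
  refine (l2TR_add_le _ _).trans (add_le_add ?_ ?_)
  · exact l2TR_le_of_abs_le fun ν b => by
      rw [abs_mul]
      exact mul_le_of_le_one_left (abs_nonneg _) (abs_gz_le_one z _)
  · have h := l2TR_le_of_forall_le (S := Fin d) (mul_nonneg hL (l2R_nonneg v)) (F := fun ν b =>
      (n * (gz n M M₀ z (nb n M ν b) - gz n M M₀ z b)) * v b) (fun ν => l2R_mul_le hL (fun b => ?_) v)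
    · rw [Fintype.card_fin] at h
      calc _ ≤ Real.sqrt d * (Lw d / M₀ * l2R v) := h
        _ = _ := by ring
    · rw [abs_mul, abs_of_pos hnpos]
      calc (n : ℝ) * |gz n M M₀ z (nb n M ν b) - gz n M M₀ z b| ≤ n * (Lw d / M₀ * (1 / n)) :=
            mul_le_mul_of_nonneg_left (abs_gz_nb_sub_le hn hM₀ z ν b) hnpos.le
        _ = Lw d / M₀ := by field_simp

/-- `‖h_z v‖ ≤ ‖v‖`. [cite: Balaban1984PropagatorsI, (1.118) p.36] -/
theorem l2R_gz_mul_le (z : Cen M M₀) (v : Bnd n M → ℝ) : l2R (fun b => gz n M M₀ z b * v b) ≤ l2R v :=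
  l2R_smul_le (abs_gz_le_one z) v

end Leibniz1

/-! ## §4 Mixed second differences of `h_z` and second-order Leibniz -/

section Mixed

variable {M : Fin d → ℕ} [hM : ∀ μ, NeZero (M μ)] {M₀ : ℕ}

/-- the first-derivative constant `K1 = max(sup|h′|, 8)` of r02's profile (`Lw d = 2d·K1`). [cite: Balaban1984PropagatorsI, (1.118) p.36, (1.121) p.37] -/
def K1 : ℝ := max (D1 hprof) 8

omit hM in
/-- `0 ≤ K1`. [cite: Balaban1984PropagatorsI, (1.121) p.37] -/
theorem K1_nonneg : 0 ≤ K1 := le_max_of_le_right (by norm_num)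

/-- **the mixed-difference constant** `Kmix = K2 + (2K1)²` (covers the axis case `K2` and the product case `(2K1)²`).
[cite: Balaban1984PropagatorsI, (1.121) p.37 («Δh»)] -/
def Kmix : ℝ := K2 + (2 * K1) ^ 2

omit hM in
/-- `0 ≤ Kmix`. [cite: Balaban1984PropagatorsI, (1.121) p.37] -/
theorem Kmix_nonneg : 0 ≤ Kmix := add_nonneg K2_nonneg (sq_nonneg _)

/-- **per-axis Lipschitz bound of the factor `h_μ` in real units**: `|h_μ(x + r) − h_μ(x)| ≤ (2K1/M₀)|r|` (spacing `≥ M₀/2` on axes with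
at least two centres; constant factor `1` on the others). [cite: Balaban1984PropagatorsI, (1.118) p.36, (1.121) p.37 («∂h»)] -/
theorem abs_prof_coord_shift_le (hM₀ : 1 ≤ M₀) (μ : Fin d) (zc x r : ℝ) :
    |prof M M₀ μ ((x + r) / sp M M₀ μ - zc) - prof M M₀ μ (x / sp M M₀ μ - zc)| ≤ 2 * K1 / M₀ * |r| := by
  have hM0 : (0 : ℝ) < M₀ := by exact_mod_cast hM₀
  have hs0 := sp_pos M M₀ μ
  by_cases h2 : 2 ≤ nCtr M M₀ μ
  · have h := abs_prof_sub_le M (M₀ := M₀) μ ((x + r) / sp M M₀ μ - zc) (x / sp M M₀ μ - zc)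
    have e : (x + r) / sp M M₀ μ - zc - (x / sp M M₀ μ - zc) = r / sp M M₀ μ := by field_simp; ring
    rw [e] at h
    have hc : |crep (nCtr M M₀ μ) (r / sp M M₀ μ)| ≤ |r| / sp M M₀ μ := by
      rw [← abs_of_pos hs0, ← abs_div, abs_of_pos hs0]
      exact abs_crep_le_abs (by exact_mod_cast lt_of_lt_of_le (by norm_num : 0 < 2) h2) _
    have hsp := half_le_sp M hM₀ h2
    have hK := K1_nonneg
    calc _ ≤ max (D1 hprof) 8 * |crep (nCtr M M₀ μ) (r / sp M M₀ μ)| := h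
      _ ≤ K1 * (|r| / sp M M₀ μ) := mul_le_mul_of_nonneg_left hc hK
      _ ≤ K1 * (|r| / (M₀ / 2)) := by
          apply mul_le_mul_of_nonneg_left _ hK
          exact div_le_div_of_nonneg_left (abs_nonneg r) (by positivity) hsp
      _ = 2 * K1 / M₀ * |r| := by field_simp
  · unfold prof
    rw [if_neg h2, if_neg h2, sub_self, abs_zero]
    have := K1_nonneg
    positivity

omit hM in
/-- `h_z` factored into the `ν`-th and `ν′`-th factors and the rest (ν ≠ ν′). [cite: Balaban1984PropagatorsI, (1.118) p.36 (h_z = Π_μ h(…))] -/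
theorem hz_eq_three (z : Cen M M₀) (w : TorR M) {ν ν' : Fin d} (hne : ν ≠ ν') :
    hz M M₀ z w = prof M M₀ ν (w.c ν / sp M M₀ ν - ((z ν).val : ℝ))
      * (prof M M₀ ν' (w.c ν' / sp M M₀ ν' - ((z ν').val : ℝ))
        * ∏ μ ∈ (Finset.univ.erase ν).erase ν', prof M M₀ μ (w.c μ / sp M M₀ μ - ((z μ).val : ℝ))) := by
  unfold hz
  rw [← Finset.mul_prod_erase Finset.univ _ (Finset.mem_univ ν),
    ← Finset.mul_prod_erase (Finset.univ.erase ν) _ (Finset.mem_erase.mpr ⟨hne.symm, Finset.mem_univ ν'⟩)]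

omit hM in
/-- the remaining factors lie in `[0, 1]`. [cite: Balaban1984PropagatorsI, (1.118) p.36] -/
theorem abs_prod_prof_le_one (z : Cen M M₀) (w : TorR M) (T : Finset (Fin d)) :
    |∏ μ ∈ T, prof M M₀ μ (w.c μ / sp M M₀ μ - ((z μ).val : ℝ))| ≤ 1 := by
  rw [abs_of_nonneg (Finset.prod_nonneg fun μ _ => prof_nonneg M M₀ μ _)]
  exact Finset.prod_le_one (fun μ _ => prof_nonneg M M₀ μ _) fun μ _ => prof_le_one M M₀ μ _

/-- **MIXED SECOND DIFFERENCES OF `h_z` ACROSS TWO AXES** (ν ≠ ν′): `|h_z(u + se_ν + te_{ν′}) − h_z(u + se_ν) − h_z(u + te_{ν′}) + h_z(u)|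
≤ (2K1/M₀)²·|s||t|` — the product structure `h_z(x) = Π_μ h((x_μ − z_μ)/M₀)` of (1.118). [cite: Balaban1984PropagatorsI, (1.118) p.36, (1.121) p.37] -/
theorem abs_hz_mixed_diff_le (hM₀ : 1 ≤ M₀) (z : Cen M M₀) (u : TorR M) {ν ν' : Fin d} (hne : ν ≠ ν') (s t : ℝ) :
    |hz M M₀ z (shift M (shift M u ν s) ν' t) - hz M M₀ z (shift M u ν s) - hz M M₀ z (shift M u ν' t) + hz M M₀ z u|
      ≤ (2 * K1 / M₀) ^ 2 * (|s| * |t|) := by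
  set R := ∏ μ ∈ (Finset.univ.erase ν).erase ν', prof M M₀ μ (u.c μ / sp M M₀ μ - ((z μ).val : ℝ)) with hR
  have hRw : ∀ w : TorR M, (∀ μ, μ ≠ ν → μ ≠ ν' → w.c μ = u.c μ) →
      ∏ μ ∈ (Finset.univ.erase ν).erase ν', prof M M₀ μ (w.c μ / sp M M₀ μ - ((z μ).val : ℝ)) = R := by
    intro w hw
    refine Finset.prod_congr rfl fun μ hμ => ?_
    have h1 : μ ≠ ν' := Finset.ne_of_mem_erase hμ
    have h2 : μ ≠ ν := Finset.ne_of_mem_erase (Finset.mem_of_mem_erase hμ)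
    rw [hw μ h2 h1]
  have e1 : hz M M₀ z (shift M (shift M u ν s) ν' t)
      = prof M M₀ ν ((u.c ν + s) / sp M M₀ ν - ((z ν).val : ℝ))
        * (prof M M₀ ν' ((u.c ν' + t) / sp M M₀ ν' - ((z ν').val : ℝ)) * R) := by
    rw [hz_eq_three z _ hne, hRw _ (fun μ h2 h1 => by rw [shift_c_of_ne M _ h1, shift_c_of_ne M _ h2])]
    simp only [shift_c_self, shift_c_of_ne M _ hne, shift_c_of_ne M _ hne.symm]
  have e2 : hz M M₀ z (shift M u ν s)
      = prof M M₀ ν ((u.c ν + s) / sp M M₀ ν - ((z ν).val : ℝ)) * (prof M M₀ ν' (u.c ν' / sp M M₀ ν' - ((z ν').val : ℝ)) * R) := by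
    rw [hz_eq_three z _ hne, hRw _ (fun μ h2 _ => by rw [shift_c_of_ne M _ h2])]
    simp only [shift_c_self, shift_c_of_ne M _ hne.symm]
  have e3 : hz M M₀ z (shift M u ν' t)
      = prof M M₀ ν (u.c ν / sp M M₀ ν - ((z ν).val : ℝ)) * (prof M M₀ ν' ((u.c ν' + t) / sp M M₀ ν' - ((z ν').val : ℝ)) * R) := by
    rw [hz_eq_three z _ hne, hRw _ (fun μ _ h1 => by rw [shift_c_of_ne M _ h1])]
    simp only [shift_c_self, shift_c_of_ne M _ hne]
  have e4 : hz M M₀ z u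
      = prof M M₀ ν (u.c ν / sp M M₀ ν - ((z ν).val : ℝ)) * (prof M M₀ ν' (u.c ν' / sp M M₀ ν' - ((z ν').val : ℝ)) * R) := by
    rw [hz_eq_three z _ hne, hRw _ (fun μ _ _ => rfl)]
  rw [e1, e2, e3, e4]
  set F1 := prof M M₀ ν ((u.c ν + s) / sp M M₀ ν - ((z ν).val : ℝ)) with hF1
  set F0 := prof M M₀ ν (u.c ν / sp M M₀ ν - ((z ν).val : ℝ)) with hF0
  set G1 := prof M M₀ ν' ((u.c ν' + t) / sp M M₀ ν' - ((z ν').val : ℝ)) with hG1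
  set G0 := prof M M₀ ν' (u.c ν' / sp M M₀ ν' - ((z ν').val : ℝ)) with hG0
  have e : F1 * (G1 * R) - F1 * (G0 * R) - F0 * (G1 * R) + F0 * (G0 * R) = (F1 - F0) * (G1 - G0) * R := by ring
  rw [e, abs_mul, abs_mul]
  have hF' : |F1 - F0| ≤ 2 * K1 / M₀ * |s| := abs_prof_coord_shift_le (M := M) hM₀ ν ((z ν).val : ℝ) (u.c ν) s
  have hG' : |G1 - G0| ≤ 2 * K1 / M₀ * |t| := abs_prof_coord_shift_le (M := M) hM₀ ν' ((z ν').val : ℝ) (u.c ν') t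
  have hR1 : |R| ≤ 1 := abs_prod_prof_le_one z u ((Finset.univ.erase ν).erase ν')
  have hK : 0 ≤ 2 * K1 / M₀ := by have := K1_nonneg; positivity
  calc |F1 - F0| * |G1 - G0| * |R| ≤ (2 * K1 / M₀ * |s|) * (2 * K1 / M₀ * |t|) * 1 :=
        mul_le_mul (mul_le_mul hF' hG' (abs_nonneg _) (by positivity)) hR1 (abs_nonneg _) (by positivity)
    _ = _ := by ring

omit hM in
/-- shifts along different axes commute. (plumbing) [cite: Balaban1984PropagatorsI, (1.121) p.37] -/
theorem shift_comm (u : TorR M) {ν ν' : Fin d} (hne : ν ≠ ν') (s t : ℝ) :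
    shift M (shift M u ν s) ν' t = shift M (shift M u ν' t) ν s := by
  simp only [shift, TorR.mk.injEq]
  rw [Function.update_of_ne hne.symm, Function.update_of_ne hne, Function.update_comm hne]

variable {n : ℕ} [NeZero n]

/-- `h_z` at the doubly shifted neighbour `b + e_ν + e_{ν′}`. [cite: Balaban1984PropagatorsI, (1.121) p.37] -/
theorem gz_nb_nb (z : Cen M M₀) {ν ν' : Fin d} (hne : ν ≠ ν') (b : Bnd n M) :
    gz n M M₀ z (nb n M ν' (nb n M ν b)) = hz M M₀ z (shift M (shift M (ucPt M n b.1) ν (1 / n)) ν' (1 / n)) := by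
  obtain ⟨k₁, hk₁⟩ := ucPt_add_unitVec (M := M) (n := n) (b.1 + unitVec (fine n M) ν) ν'
  obtain ⟨k₂, hk₂⟩ := ucPt_add_unitVec (M := M) (n := n) b.1 ν
  rw [gz, nb_fst, nb_fst, hk₁, ← shift_shift, hz_shift_period, hk₂, ← shift_shift, shift_comm _ hne,
    hz_shift_period]

/-- **MIXED AND AXIS SECOND DIFFERENCES OF `h_z` ALONG THE LATTICE**: for all `ν, ν′`,
`|h_z(b + e_ν + e_{ν′}) − h_z(b + e_ν) − h_z(b + e_{ν′}) + h_z(b)| ≤ Kmix/M₀²·η²`. [cite: Balaban1984PropagatorsI, (1.121) p.37 («Δh»)] -/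
theorem abs_gz_mixed_le (hM₀ : 1 ≤ M₀) (z : Cen M M₀) (ν ν' : Fin d) (b : Bnd n M) :
    |gz n M M₀ z (nb n M ν' (nb n M ν b)) - gz n M M₀ z (nb n M ν b) - gz n M M₀ z (nb n M ν' b) + gz n M M₀ z b|
      ≤ Kmix / (M₀ : ℝ) ^ 2 * (1 / n) ^ 2 := by
  have hM0 : (0 : ℝ) < M₀ := by exact_mod_cast hM₀
  have hK2 := K2_nonneg
  have hK1 := K1_nonneg
  by_cases hne : ν = ν'
  · subst hne
    have h := abs_gz_second_diff_le (n := n) hM₀ z ν (nb n M ν b)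
    rw [pb_nb] at h
    have e : gz n M M₀ z (nb n M ν (nb n M ν b)) - gz n M M₀ z (nb n M ν b) - gz n M M₀ z (nb n M ν b) + gz n M M₀ z b
        = gz n M M₀ z (nb n M ν (nb n M ν b)) - 2 * gz n M M₀ z (nb n M ν b) + gz n M M₀ z b := by ring
    rw [e]
    refine h.trans (mul_le_mul_of_nonneg_right ?_ (sq_nonneg _))
    unfold Kmix
    exact div_le_div_of_nonneg_right (by nlinarith) (sq_nonneg _)
  · rw [gz_nb_nb z hne, gz_nb, gz_nb, gz]
    have h := abs_hz_mixed_diff_le hM₀ z (ucPt M n b.1) hne (1 / n) (1 / n)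
    have hn0 : (0 : ℝ) ≤ 1 / n := by positivity
    rw [abs_of_nonneg hn0] at h
    refine h.trans ?_
    have e : (2 * K1 / (M₀ : ℝ)) ^ 2 * (1 / n * (1 / n)) = (2 * K1) ^ 2 / (M₀ : ℝ) ^ 2 * (1 / n) ^ 2 := by
      field_simp
    rw [e]
    refine mul_le_mul_of_nonneg_right (div_le_div_of_nonneg_right ?_ (sq_nonneg _)) (sq_nonneg _)
    unfold Kmix
    linarith

/-- **SECOND-ORDER LEIBNIZ, ONE PAIR OF AXES**: `∇_ν∇_{ν′}(g·v)(b) = g(b+e_ν+e_{ν′})·∇_ν∇_{ν′}v(b) + n(g(b+e_ν+e_{ν′}) − g(b+e_{ν′}))·∇_{ν′}v(b)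
+ n(g(b+e_ν+e_{ν′}) − g(b+e_ν))·∇_νv(b) + n²(Δ_{νν′}g)(b)·v(b)`. [cite: Balaban1984PropagatorsI, (1.121) p.37] -/
theorem grad2R_mul_apply (g v : Bnd n M → ℝ) (p : Fin d × Fin d) (b : Bnd n M) :
    grad2R n M (fun b' => g b' * v b') p b
      = g (nb n M p.2 (nb n M p.1 b)) * grad2R n M v p b
        + (n * (g (nb n M p.2 (nb n M p.1 b)) - g (nb n M p.2 b))) * (fdiffR n M p.2 *ᵥ v) b
        + (n * (g (nb n M p.2 (nb n M p.1 b)) - g (nb n M p.1 b))) * (fdiffR n M p.1 *ᵥ v) b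
        + ((n : ℝ) ^ 2 * (g (nb n M p.2 (nb n M p.1 b)) - g (nb n M p.1 b) - g (nb n M p.2 b) + g b)) * v b := by
  have key : ∀ w : Bnd n M → ℝ, (fdiffR n M p.1 *ᵥ (fdiffR n M p.2 *ᵥ w)) b
      = (n : ℝ) ^ 2 * (w (nb n M p.2 (nb n M p.1 b)) - w (nb n M p.1 b) - w (nb n M p.2 b) + w b) := by
    intro w
    rw [fdiffR_mulVec_apply, fdiffR_mulVec_apply, fdiffR_mulVec_apply]
    ring
  simp only [grad2R, key, fdiffR_mulVec_apply]
  ring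

omit hM [NeZero n] in
/-- the two forward neighbours in either order coincide. (plumbing) [cite: Balaban1984PropagatorsI, (1.31) p.23] -/
theorem nb_nb_comm (ν ν' : Fin d) (b : Bnd n M) : nb n M ν' (nb n M ν b) = nb n M ν (nb n M ν' b) := by
  obtain ⟨x, μ⟩ := b
  simp only [nb, add_right_comm]

/-- **`‖∇_ν∇_{ν′}(h_z v)‖ ≤ ‖∇_ν∇_{ν′}v‖ + (Lw/M₀)(‖∇_{ν′}v‖ + ‖∇_νv‖) + (Kmix/M₀²)‖v‖`**, uniformly in `η`.
[cite: Balaban1984PropagatorsI, (1.121) p.37, (1.125) p.38] -/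
theorem l2R_grad2R_gz_mul_le (hn : 1 ≤ n) (hM₀ : 1 ≤ M₀) (z : Cen M M₀) (v : Bnd n M → ℝ) (p : Fin d × Fin d) :
    l2R (grad2R n M (fun b => gz n M M₀ z b * v b) p)
      ≤ l2R (grad2R n M v p) + Lw d / M₀ * (l2R (fdiffR n M p.2 *ᵥ v) + l2R (fdiffR n M p.1 *ᵥ v))
        + Kmix / (M₀ : ℝ) ^ 2 * l2R v := by
  have hnpos : (0 : ℝ) < n := Nat.cast_pos.mpr (NeZero.pos n)
  have hL : 0 ≤ Lw d / M₀ := div_nonneg (Lw_nonneg d) (Nat.cast_nonneg _)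
  have hK : 0 ≤ Kmix / (M₀ : ℝ) ^ 2 := div_nonneg Kmix_nonneg (sq_nonneg _)
  set g := gz n M M₀ z with hg
  set T1 : Bnd n M → ℝ := fun b => g (nb n M p.2 (nb n M p.1 b)) * grad2R n M v p b with hT1
  set T2 : Bnd n M → ℝ := fun b => (n * (g (nb n M p.2 (nb n M p.1 b)) - g (nb n M p.2 b))) * (fdiffR n M p.2 *ᵥ v) b
    with hT2
  set T3 : Bnd n M → ℝ := fun b => (n * (g (nb n M p.2 (nb n M p.1 b)) - g (nb n M p.1 b))) * (fdiffR n M p.1 *ᵥ v) b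
    with hT3
  set T4 : Bnd n M → ℝ := fun b =>
    ((n : ℝ) ^ 2 * (g (nb n M p.2 (nb n M p.1 b)) - g (nb n M p.1 b) - g (nb n M p.2 b) + g b)) * v b with hT4
  have e : grad2R n M (fun b => g b * v b) p = T1 + T2 + T3 + T4 := by
    funext b
    simp only [hT1, hT2, hT3, hT4, Pi.add_apply]
    exact grad2R_mul_apply g v p b
  have h1 : l2R T1 ≤ l2R (grad2R n M v p) := l2R_smul_le (fun b => abs_gz_le_one z _) _
  have h2 : l2R T2 ≤ Lw d / M₀ * l2R (fdiffR n M p.2 *ᵥ v) := by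
    refine l2R_mul_le hL (fun b => ?_) _
    rw [abs_mul, abs_of_pos hnpos, nb_nb_comm]
    calc (n : ℝ) * |g (nb n M p.1 (nb n M p.2 b)) - g (nb n M p.2 b)| ≤ n * (Lw d / M₀ * (1 / n)) :=
          mul_le_mul_of_nonneg_left (abs_gz_nb_sub_le hn hM₀ z p.1 (nb n M p.2 b)) hnpos.le
      _ = Lw d / M₀ := by field_simp
  have h3 : l2R T3 ≤ Lw d / M₀ * l2R (fdiffR n M p.1 *ᵥ v) := by
    refine l2R_mul_le hL (fun b => ?_) _
    rw [abs_mul, abs_of_pos hnpos]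
    calc (n : ℝ) * |g (nb n M p.2 (nb n M p.1 b)) - g (nb n M p.1 b)| ≤ n * (Lw d / M₀ * (1 / n)) :=
          mul_le_mul_of_nonneg_left (abs_gz_nb_sub_le hn hM₀ z p.2 (nb n M p.1 b)) hnpos.le
      _ = Lw d / M₀ := by field_simp
  have h4 : l2R T4 ≤ Kmix / (M₀ : ℝ) ^ 2 * l2R v := by
    refine l2R_mul_le hK (fun b => ?_) _
    rw [abs_mul, abs_of_nonneg (by positivity : (0 : ℝ) ≤ (n : ℝ) ^ 2)]
    calc (n : ℝ) ^ 2 * |g (nb n M p.2 (nb n M p.1 b)) - g (nb n M p.1 b) - g (nb n M p.2 b) + g b|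
        ≤ (n : ℝ) ^ 2 * (Kmix / (M₀ : ℝ) ^ 2 * (1 / n) ^ 2) :=
          mul_le_mul_of_nonneg_left (abs_gz_mixed_le hM₀ z p.1 p.2 b) (by positivity)
      _ = Kmix / (M₀ : ℝ) ^ 2 := by field_simp
  have h12 := l2R_add_le T1 T2
  have h123 := l2R_add_le (T1 + T2) T3
  have h1234 := l2R_add_le (T1 + T2 + T3) T4
  rw [e]
  linarith

/-- **SECOND-ORDER LEIBNIZ IN `L²`**: `‖∇∇(h_z v)‖ ≤ d²·(‖∇∇v‖ + 2(Lw/M₀)‖∇v‖ + (Kmix/M₀²)‖v‖)` — «∂h», «Δh» of (1.121) for the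
`∇∇` entries, uniformly in `η`, the volume and `M₀ ≥ 1`. [cite: Balaban1984PropagatorsI, (1.121) p.37, (1.125) p.38, Prop. 1.2 (1.114) p.36 (‖ζ∇∇GJ‖)] -/
theorem l2TR_grad2R_gz_mul_le (hn : 1 ≤ n) (hM₀ : 1 ≤ M₀) (z : Cen M M₀) (v : Bnd n M → ℝ) :
    l2TR (grad2R n M fun b => gz n M M₀ z b * v b)
      ≤ (d : ℝ) ^ 2 * (l2TR (grad2R n M v) + 2 * (Lw d / M₀) * l2TR (gradR n M v) + Kmix / (M₀ : ℝ) ^ 2 * l2R v) := by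
  have hL : 0 ≤ Lw d / M₀ := div_nonneg (Lw_nonneg d) (Nat.cast_nonneg _)
  refine (l2TR_le_sum_l2R _).trans ?_
  have hp : ∀ p : Fin d × Fin d, l2R (grad2R n M (fun b => gz n M M₀ z b * v b) p)
      ≤ l2TR (grad2R n M v) + 2 * (Lw d / M₀) * l2TR (gradR n M v) + Kmix / (M₀ : ℝ) ^ 2 * l2R v := by
    intro p
    have h := l2R_grad2R_gz_mul_le hn hM₀ z v p
    have h1 : l2R (grad2R n M v p) ≤ l2TR (grad2R n M v) := l2R_le_l2TR _ p
    have h2 : l2R (fdiffR n M p.2 *ᵥ v) ≤ l2TR (gradR n M v) := l2R_le_l2TR (gradR n M v) p.2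
    have h3 : l2R (fdiffR n M p.1 *ᵥ v) ≤ l2TR (gradR n M v) := l2R_le_l2TR (gradR n M v) p.1
    nlinarith
  calc ∑ p, l2R (grad2R n M (fun b => gz n M M₀ z b * v b) p)
      ≤ ∑ _p : Fin d × Fin d, (l2TR (grad2R n M v) + 2 * (Lw d / M₀) * l2TR (gradR n M v) + Kmix / (M₀ : ℝ) ^ 2 * l2R v) :=
        Finset.sum_le_sum fun p _ => hp p
    _ = _ := by
        rw [Finset.sum_const, Finset.card_univ, Fintype.card_prod, Fintype.card_fin, nsmul_eq_mul, Nat.cast_mul]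
        ring

end Mixed

/-! ## §5 The divergence commutator: `h·∇*J = ∇*(h·J) + E` -/

section DivComm

variable {n : ℕ} [NeZero n] {M : Fin d → ℕ} [hM : ∀ μ, NeZero (M μ)] {M₀ : ℕ}

/-- the commutator remainder `E = Σ_ν n(g(b) − g(b − e_ν))·J_ν(b − e_ν)`. [cite: Balaban1984PropagatorsI, p.39 («K(h) acting on the right»), (1.121) p.37] -/
def Ediv (g : Bnd n M → ℝ) (J : Fin d → Bnd n M → ℝ) : Bnd n M → ℝ :=
  ∑ ν, fun b => (n * (g b - g (pb n M ν b))) * J ν (pb n M ν b)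

/-- **`g·(∇*J) = ∇*(g·J) + E`**. [cite: Balaban1984PropagatorsI, p.39, (1.121) p.37] -/
theorem mul_divTR_eq (g : Bnd n M → ℝ) (J : Fin d → Bnd n M → ℝ) :
    (fun b => g b * divTR n M J b) = divTR n M (fun ν b => g b * J ν b) + Ediv g J := by
  funext b
  simp only [divTR, Ediv, Pi.add_apply, Finset.sum_apply, fdiffR_transpose_mulVec_apply, Finset.mul_sum,
    ← Finset.sum_add_distrib]
  exact Finset.sum_congr rfl fun ν _ => by ring

/-- **`‖E‖ ≤ d·(Lw/M₀)·‖J‖`**. [cite: Balaban1984PropagatorsI, (1.121) p.37, (1.129) p.38] -/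
theorem l2R_Ediv_le (hn : 1 ≤ n) (hM₀ : 1 ≤ M₀) (z : Cen M M₀) (J : Fin d → Bnd n M → ℝ) :
    l2R (Ediv (gz n M M₀ z) J) ≤ d * (Lw d / M₀) * l2TR J := by
  have hnpos : (0 : ℝ) < n := Nat.cast_pos.mpr (NeZero.pos n)
  have hL : 0 ≤ Lw d / M₀ := div_nonneg (Lw_nonneg d) (Nat.cast_nonneg _)
  unfold Ediv
  refine (l2R_sum_le _ _).trans ?_
  have hν : ∀ ν : Fin d, l2R (fun b => (n * (gz n M M₀ z b - gz n M M₀ z (pb n M ν b))) * J ν (pb n M ν b))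
      ≤ Lw d / M₀ * l2TR J := by
    intro ν
    refine (l2R_mul_le hL (fun b => ?_) _).trans (mul_le_mul_of_nonneg_left ?_ hL)
    · rw [abs_mul, abs_of_pos hnpos, abs_sub_comm]
      calc (n : ℝ) * |gz n M M₀ z (pb n M ν b) - gz n M M₀ z b| ≤ n * (Lw d / M₀ * (1 / n)) :=
            mul_le_mul_of_nonneg_left (abs_gz_pb_sub_le hn hM₀ z ν b) hnpos.le
        _ = Lw d / M₀ := by field_simp
    · have e : l2R (fun b => J ν (pb n M ν b)) = l2R (J ν) :=
        l2R_comp_equiv (nbEquiv (n := n) (M := M) ν).symm (J ν)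
      rw [e]
      exact l2R_le_l2TR J ν
  calc ∑ ν, l2R (fun b => (n * (gz n M M₀ z b - gz n M M₀ z (pb n M ν b))) * J ν (pb n M ν b))
      ≤ ∑ _ν : Fin d, Lw d / M₀ * l2TR J := Finset.sum_le_sum fun ν _ => hν ν
    _ = _ := by rw [Finset.sum_const, Finset.card_univ, Fintype.card_fin, nsmul_eq_mul, mul_assoc]

end DivComm

end

end Literature.MathematicalPhysics.QuantumFieldTheory.Balaban1983to89.B5WalkLeibnizTorus
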